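import Summits.QuantumFields.YangMills.Theorems.TunedSequenceExists.Negative.Freezing

/-!
# Scratch certificate for stub `stub_femtoWindow` (line `fixed-aspect-window`, crux stmt-QuantumFields-10524)

NOT the stub (which is research-level: Bałaban's finite-physical-volume UV stability with two
`tr F²` insertions and a two-sided leading term).  Two kernel-checked facts for the lead's census:

* `femtoWindow_fails_at_fixed_depth` — at every FIXED depth `m` (and aspect `L₁ ≥ 2`) the stub's
  inequality fails for all large `β` (landed `Negative.Freezing`): the stub cannot be witnessed by
  one positive value + continuity; any proof must produce infinitely many depths `m → ∞` with the
  SAME constant `c` (the tuned crossover `β ≍ log M^m`, i.e. asymptotic freedom).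
* `OneLoopFemtoRunning` — the exact missing estimate as a Lean `Prop` (lower half of the two-sided
  one-loop running bound along the logarithmic coupling trajectory `β⋆ = b log(L₁ M^m) + β_c`,
  torus pinned at Bałaban's threshold), and `femtoWindow_of_oneLoopFemtoRunning` — it implies the
  stub body at fixed data by elementary arithmetic (`β⋆ → ∞` with `m`).
-/

noncomputable section

open Filter Topology MeasureTheory
open Literature.MathematicalPhysics.QuantumFieldTheory Literature.MathematicalPhysics.QuantumLattice

namespace Summit.QuantumFields.YangMills.Theorems.TunedSequenceExists.FixedAspectWindow.Scratch

variable {G : Type} [Group G] [TopologicalSpace G] [IsTopologicalGroup G] [CompactSpace G]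
  [MeasurableSpace G] [BorelSpace G]

/-- At a FIXED depth `m` the femto inequality fails for all large `β` (freezing on the fixed
torus of side `2 L₁ M^m + 1`). -/
theorem femtoWindow_fails_at_fixed_depth (r : LatticeRep G) (M L₁ m : ℕ) {c : ℝ} (hc : 0 < c)
    (hL₁ : 2 ≤ L₁) :
    ∀ᶠ β : ℝ in atTop, ((M : ℝ) ^ m) ^ 8 *
        latticeConnectedCorr r.ρ β (2 * (L₁ * M ^ m) + 1) r.curvature.F r.curvature.F (M ^ m) <
      c / Real.log L₁ ^ 2 := by
  have hlog : 0 < Real.log L₁ := Real.log_pos (by exact_mod_cast hL₁)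
  have hpos : (0 : ℝ) < c / Real.log L₁ ^ 2 := div_pos hc (pow_pos hlog 2)
  have h := (Negative.Freezing.latticeConnectedCorr_curvature_tendsto_zero r
    (2 * (L₁ * M ^ m) + 1) (M ^ m)).const_mul (((M : ℝ) ^ m) ^ 8)
  rw [mul_zero] at h
  exact h.eventually_lt_const hpos

/-- Hence no FINITE set of depths can serve a given aspect ratio: beyond some coupling floor `B`
every depth in the set fails at every `β ≥ B`. -/
theorem femtoWindow_fails_on_finset (r : LatticeRep G) (M L₁ : ℕ) (F : Finset ℕ) {c : ℝ}
    (hc : 0 < c) (hL₁ : 2 ≤ L₁) :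
    ∃ B : ℝ, ∀ m ∈ F, ∀ β : ℝ, B ≤ β → ((M : ℝ) ^ m) ^ 8 *
        latticeConnectedCorr r.ρ β (2 * (L₁ * M ^ m) + 1) r.curvature.F r.curvature.F (M ^ m) <
      c / Real.log L₁ ^ 2 := by
  have h : ∀ᶠ β : ℝ in atTop, ∀ m ∈ F, ((M : ℝ) ^ m) ^ 8 *
        latticeConnectedCorr r.ρ β (2 * (L₁ * M ^ m) + 1) r.curvature.F r.curvature.F (M ^ m) <
      c / Real.log L₁ ^ 2 :=
    (F.eventually_all).2 fun m _ => femtoWindow_fails_at_fixed_depth r M L₁ m hc hL₁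
  obtain ⟨B, hB⟩ := eventually_atTop.1 h
  exact ⟨B, fun m hm β hβ => hB β hβ m hm⟩

/-- **The exact missing estimate** (lower half of the two-sided one-loop running bound in finite
physical volume): along the logarithmic coupling trajectory `β⋆(m, L₁) = b log(L₁ M^m) + β_c`
(`b = 4 b₀` in the tree's normalisation `β = 2/g₀²`; the torus of side `2 L₁ M^m + 1` pinned at
Bałaban's small-field threshold), the canonically rescaled curvature two-point function at
separation `M^m` is at least `κ / log² L₁`, eventually in the depth `m`, for all large aspect ratios
`L₁` (`κ ≈ dim G · κ₀ / (16 b₀²)`: two-gluon exchange with the coupling run from the torus scale to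
the separation scale).  Bałaban CMP 109/116/119/122 control the effective densities along this
trajectory but print no bound for gauge-invariant insertions (CMP 122-II p. 356). -/
def OneLoopFemtoRunning (r : LatticeRep G) (M : ℕ) : Prop :=
  ∃ b βc κ : ℝ, 0 < b ∧ 0 < κ ∧ ∃ LU : ℕ, ∀ L₁ : ℕ, LU ≤ L₁ → 2 ≤ L₁ → ∃ m₁ : ℕ, ∀ m : ℕ, m₁ ≤ m →
    κ / Real.log L₁ ^ 2 ≤ ((M : ℝ) ^ m) ^ 8 *
      latticeConnectedCorr r.ρ (b * Real.log ((L₁ : ℝ) * (M : ℝ) ^ m) + βc) (2 * (L₁ * M ^ m) + 1)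
        r.curvature.F r.curvature.F (M ^ m)

/-- The missing estimate implies the stub body at fixed data (`FemtoWindow r M` of the skeleton),
by elementary arithmetic: `β⋆(m, L₁) → ∞` with `m` since `M ≥ 2`. -/
theorem femtoWindow_of_oneLoopFemtoRunning (r : LatticeRep G) {M : ℕ} (hM : 2 ≤ M)
    (h : OneLoopFemtoRunning r M) :
    ∃ c : ℝ, 0 < c ∧ ∃ LU : ℕ, ∀ L₁ : ℕ, LU ≤ L₁ → 2 ≤ L₁ → ∀ (B : ℝ) (m₀ : ℕ),
      ∃ m : ℕ, m₀ ≤ m ∧ ∃ β : ℝ, B ≤ β ∧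
        c / Real.log L₁ ^ 2 ≤ ((M : ℝ) ^ m) ^ 8 *
          latticeConnectedCorr r.ρ β (2 * (L₁ * M ^ m) + 1) r.curvature.F r.curvature.F (M ^ m) := by
  obtain ⟨b, βc, κ, hb, hκ, LU, hLU⟩ := h
  refine ⟨κ, hκ, LU, fun L₁ hL hL2 B m₀ => ?_⟩
  obtain ⟨m₁, hm₁⟩ := hLU L₁ hL hL2
  set m : ℕ := max (max m₀ m₁) ⌈Real.exp ((B - βc) / b)⌉₊ with hm
  refine ⟨m, (le_max_left _ _).trans (le_max_left _ _), _, ?_, hm₁ m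
    ((le_max_right _ _).trans (le_max_left _ _))⟩
  -- `B ≤ b log(L₁ M^m) + βc` because `exp((B - βc)/b) ≤ m < 2^m ≤ M^m ≤ L₁ M^m`
  have hMpow : (m : ℝ) < (M : ℝ) ^ m := by
    have h1 : m < 2 ^ m := Nat.lt_two_pow_self
    have h2 : 2 ^ m ≤ M ^ m := Nat.pow_le_pow_left hM m
    exact_mod_cast h1.trans_le h2
  have hL₁ : (1 : ℝ) ≤ L₁ := by exact_mod_cast (by omega : 1 ≤ L₁)
  have hexp : Real.exp ((B - βc) / b) ≤ (L₁ : ℝ) * (M : ℝ) ^ m := by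
    have h1 : Real.exp ((B - βc) / b) ≤ m := (Nat.le_ceil _).trans (by exact_mod_cast le_max_right _ _)
    have h2 : (M : ℝ) ^ m ≤ (L₁ : ℝ) * (M : ℝ) ^ m := le_mul_of_one_le_left (by positivity) hL₁
    exact h1.trans (hMpow.le.trans h2)
  have hlog : (B - βc) / b ≤ Real.log ((L₁ : ℝ) * (M : ℝ) ^ m) := by
    rw [← Real.log_exp ((B - βc) / b)]
    exact Real.log_le_log (Real.exp_pos _) hexp
  rw [div_le_iff₀ hb] at hlog
  linarith
end Summit.QuantumFields.YangMills.Theorems.TunedSequenceExists.FixedAspectWindow.Scratch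

end
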